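import Literature.Computability.AlgebraicComplexity.ExactVP0Calculus
import Literature.Computability.AlgebraicComplexity.PITLanguageCoRP
import Literature.Barriers.ValiantsHypothesis.BIJL18Thm5OfRandomizedPIT
import HarnessLib

/-!
# Bläser–Ikenmeyer–Jindal–Lysikov 2018, Thm. 5 in the PRINTED reading of `VP⁰` / `VNP⁰`
# (fan-in exactly two): `BIJL2018_thm5_exact`

Theorem-only companion of `BIJL18PermanentZero.lean` (typed fact `BIJL2018_thm5`),
`BIJL18Thm5OfRandomizedPIT.lean` (the reduction to a randomised identity test) and
`BIJL18Thm5Holds.lean` (the discharge `BIJL2018_thm5_holds`). Those files state the hypothesis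
`VP⁰ = VNP⁰` with the tree's classes `IsVP0Family` / `IsVNP0Family` of
`ConstantFreeValiant.lean`, whose circuits have fan-in AT MOST two (`IsFanInTwo`), hence may
contain the empty gates `Σ ∅ = 0`, `Π ∅ = 1` of formal degree `0` (registry finding B41; kernel
witness `VP0EmptyGateConstants.exists_isVP0Family_not_exactFanInTwo`). The printed classes
(Bürgisser, *On defining integers and proving arithmetic circuit lower bounds*, Def. 2.7–2.8 =
BIJL App. A Def. 29: "all nodes except the input nodes have fan-in 2") are the tree's
`IsExactVP0Family` / `IsExactVNP0Family` (`ExactVP0Calculus.lean`); the two hypotheses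
`∀ F, IsVNP0Family F → IsVP0Family F` and `∀ F, IsExactVNP0Family F → IsExactVP0Family F` are
formally incomparable. This file proves the theorem with the hypothesis taken VERBATIM over the
printed classes:

* `isExactVNP0Family_perPoly_finProd` — `PER ∈ VNP⁰` (printed reading) for the permanent family in
  the variables `Fin (n·n)` (Ryser witness of `ExactVP0Calculus.isExactVNP0Family_perPoly`, renamed);
* `isPBounded_constantFreeComplexity_perPoly_of_exactVP0EqVNP0` — under the printed
  `VP⁰ = VNP⁰`, `τ(per_n)` is p-bounded (via `IsExactVP0Family.isVP0Family` and
  `IsVP0Family.isPBounded_constantFreeComplexity`);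
* **`BIJL2018_thm5_exact`** — `(∀ F, IsExactVNP0Family F.poly → IsExactVP0Family F.poly) →
  P^{#P} ⊆ ∃·BPP`, by `PSharpP_subset_polyExists_BPP_of_agree_kiRed` with the tree's randomised
  identity test `PITLanguage_mem_BPP` (the same assembly as `BIJL2018_thm5_holds`; the deviation
  from the printed verification step is disclosed there).

HONEST FRAMING: a 2018 conditional transfer theorem with a Boolean conclusion; `VP ≠ VNP` is NOT
proved and nothing here bears on it. No new definitions, no facts.

## References

* M. Bläser, C. Ikenmeyer, G. Jindal, V. Lysikov, *Generalized matrix completion and algebraic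
  natural proofs*, STOC 2018 = ECCC TR18-064, Thm. 5 (p. 6), §6 (pp. 18–19), App. A Def. 29
  [BlaserIkenmeyerJindalLysikov2018].
* P. Bürgisser, *On defining integers and proving arithmetic circuit lower bounds*,
  Comput. Complexity 18 (2009) = ECCC TR06-113, §2.2, Def. 2.7–2.8 [Burgisser2006].
* V. Kabanets, R. Impagliazzo, *Derandomizing polynomial identity tests means proving circuit
  lower bounds*, STOC 2003, Lemma 3, Lemma 11, Cor. 12 [KabanetsImpagliazzo2003].
-/


/-! ### BIJL 2018, Thm. 5 in the printed (fan-in exactly two) reading -/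

namespace Literature.Barriers.ValiantsHypothesis

open Literature.Computability.AlgebraicComplexity Literature.Computability.Complexity MvPolynomial
open _root_.Computability

/-- **`PER ∈ VNP⁰` (printed reading) as a `PolyFamily ℤ`**: the permanent family renamed to the
variables `Fin (n·n)`, with the Ryser witness renamed along `Sum.map finProdFinEquiv id`
(`HasTauDeg₁.rename`; `boolSum_rename_sumMap`). [cite: BlaserIkenmeyerJindalLysikov2018, §6 (p. 17) and Def. 29]
[cite: Burgisser2006, Def. 2.8] -/
theorem isExactVNP0Family_perPoly_finProd :
    IsExactVNP0Family (σ := fun n => Fin (n * n))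
      fun n => rename (finProdFinEquiv : Fin n × Fin n ≃ Fin (n * n)) (perPoly (Fin n) ℤ) := by
  refine ⟨fun n => n, fun n => rename (Sum.map (finProdFinEquiv : Fin n × Fin n ≃ Fin (n * n)) id)
    (perVNPWitness n ℤ), ?_, fun n => ?_⟩
  · refine IsExactVP0Family.of_hasTauDeg₁ ?_ (s := fun n => 2 * n * n + 4 * n + 1)
      (d := fun n => 3 * n + 2) ?_ ?_ fun n => (hasTauDeg₁_perVNPWitness n).rename _
    · refine (IsPBounded.iff_exists_le_mul_succ_pow _).2 ⟨1, 2, fun n => ?_⟩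
      have e : 1 * (n + 1) ^ 2 = n * n + 2 * n + 1 := by ring
      simp only [Fintype.card_sum, Fintype.card_fin]
      omega
    · refine (IsPBounded.iff_exists_le_mul_succ_pow _).2 ⟨4, 2, fun n => ?_⟩
      have e : 4 * (n + 1) ^ 2 = 4 * n * n + 8 * n + 4 := by ring
      rw [e]; nlinarith
    · exact (IsPBounded.iff_exists_le_mul_succ_pow _).2 ⟨3, 1, fun n => by rw [pow_one]; omega⟩
  · rw [boolSum_rename_sumMap, boolSum_perVNPWitness]

/-- **Under the printed `VP⁰ = VNP⁰` the permanent has p-bounded constant-free complexity**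
(printed reading of `isPBounded_constantFreeComplexity_perPoly_of_vp0EqVNP0`).
[cite: BlaserIkenmeyerJindalLysikov2018, Thm. 5 (proof, §6)] -/
theorem isPBounded_constantFreeComplexity_perPoly_of_exactVP0EqVNP0
    (h : ∀ F : PolyFamily ℤ, IsExactVNP0Family F.poly → IsExactVP0Family F.poly) :
    IsPBounded fun n => constantFreeComplexity (perPoly (Fin n) ℤ) := by
  have hVP := (h ⟨fun n => n * n,
    fun n => rename (finProdFinEquiv : Fin n × Fin n ≃ Fin (n * n)) (perPoly (Fin n) ℤ)⟩
    isExactVNP0Family_perPoly_finProd).isVP0Family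
  have hcard : IsPBounded fun n => Fintype.card (Fin n × Fin n) := by
    refine (IsPBounded.iff_exists_le_mul_succ_pow _).2 ⟨1, 2, fun n => ?_⟩
    have e : 1 * (n + 1) ^ 2 = n * n + 2 * n + 1 := by ring
    simp only [Fintype.card_prod, Fintype.card_fin]
    omega
  have hVP' := hVP.rename (fun n => ((finProdFinEquiv : Fin n × Fin n ≃ Fin (n * n)).symm :
    Fin (n * n) → Fin n × Fin n)) hcard
  have e : (fun n => rename ((finProdFinEquiv : Fin n × Fin n ≃ Fin (n * n)).symm :
      Fin (n * n) → Fin n × Fin n)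
      (rename (finProdFinEquiv : Fin n × Fin n ≃ Fin (n * n)) (perPoly (Fin n) ℤ))) =
      fun n => perPoly (Fin n) ℤ := by
    funext n
    rw [rename_rename, Equiv.symm_comp_self, rename_id]
    rfl
  rw [e] at hVP'
  exact hVP'.isPBounded_constantFreeComplexity

/-- **Bläser–Ikenmeyer–Jindal–Lysikov 2018, Thm. 5, in the PRINTED reading of `VP⁰`/`VNP⁰`**
(fan-in exactly two, Bürgisser 2009 Def. 2.7–2.8 = BIJL App. A Def. 29): "If `VP⁰ = VNP⁰` over
characteristic zero, then `P^{#P} ⊆ ∃BPP`." The tree's discharged fact `BIJL2018_thm5` is the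
same sentence for the tree's larger classes `IsVP0Family`/`IsVNP0Family` (fan-in at most two;
registry B41), a formally incomparable hypothesis; this twin takes the hypothesis verbatim over
the printed classes `IsExactVP0Family`/`IsExactVNP0Family`. Proof = the landed chain: the
hypothesis is used only at the permanent (`isExactVNP0Family_perPoly_finProd`), giving p-bounded
constant-free complexity of `per_n`, then guess-and-verify with the tree's randomised identity
test `PITLanguage_mem_BPP` (`PSharpP_subset_polyExists_BPP_of_agree_kiRed`; deviation from the
printed verification as disclosed at `BIJL2018_thm5_holds`).
[cite: BlaserIkenmeyerJindalLysikov2018, Thm. 5] locator: ECCC TR18-064 p.6 (statement), pp.18–19 (proof), App. A Def. 29 -/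
theorem BIJL2018_thm5_exact :
    (∀ F : PolyFamily ℤ, IsExactVNP0Family F.poly → IsExactVP0Family F.poly) →
      PSharpP ⊆ polyExists BPP :=
  fun h => PSharpP_subset_polyExists_BPP_of_agree_kiRed PITLanguage_mem_BPP (fun _ => Iff.rfl)
    (isPBounded_constantFreeComplexity_perPoly_of_exactVP0EqVNP0 h)

end Literature.Barriers.ValiantsHypothesis
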